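import Summits.ValiantsHypothesis.ValiantsHypothesis.Theorems.KPlusLogSqLawWeakLiftingTowerGraftTwoSidedSplitFamily
import Summits.ValiantsHypothesis.ValiantsHypothesis.Theorems.KPlusLogSqLawWeakLiftingTowerGraftTwoSidedClusteredAll
import Summits.ValiantsHypothesis.ValiantsHypothesis.Theorems.KPlusLogSqLawWeakLiftingTowerGraftTwoSidedThreeLettersDefinite
import Summits.ValiantsHypothesis.ValiantsHypothesis.Theorems.LacunarySymmetroidMatrixDescartesInertiaIndexFormula

/-!
# Tower graft line — one-pivot words: the census laws for DEFINITE-TYPE roots of ANY CORANK (clustered and commensurable supports)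

Crux `stmt-ValiantsHypothesis-19561` (`WeakLifting`), line (B) `tower_graft`, two-sided word instrument; seat val-sym-lift-p3 g21,
`--supports 19561`, NO stub claimed.  `…TwoSidedClusteredAll` / `…TwoSidedCommensurable` prove their census laws under SIMPLE CROSSINGS.
Here the corank restriction is removed once and for all through an ABSTRACT theorem (`card_posRoots_le_of_negType_family_law`): if every
family of entering-type kernel pairs of the reduced word (scales may repeat, same-scale pairs polarised) has at most `R` members, then —
for definite-type roots of any corank — `Z₊ ≤ 2R` with multiplicity (`Inertia.sum_corank_eq_card_roots_filter`, orthogonal kernel bases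
`exists_kernel_orthogonal_family` for the type form `e P₀ − Σₗ (δₗ − e) t^{δₗ} Pₗ`, `Inertia.global_index_formula`).  Instances
(`…TwoSidedSplitFamily`): ★ `card_posRoots_le_two_mul_clustered_of_definite` (clustered words of any length: `Z₊ ≤ 2m`) and
★ `card_posRoots_le_commensurable_of_definite` (commensurable supports, towers included: `Z₊ ≤ 2(m + m Σₗ qₗ)`).  What remains outside the
series: NEUTRAL kernel vectors.  HONEST FRAMING: structural laws for one-pivot words; nothing on S4…S5, `TowerB`, `WeakLifting` in its
window, Conjecture B, 18050 or `VP ≠ VNP`.  Def-free.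

[folklore] the inertia kit + split certificates.
-/

set_option linter.dupNamespace false
set_option autoImplicit false

namespace Summit.ValiantsHypothesis.ValiantsHypothesis.Theorems.KPlusLogSqLaw.TowerGraft

open Matrix
open scoped BigOperators

namespace TwoSidedThree

/-! ## The census law for DEFINITE-TYPE roots of any corank, from an abstract entering-type FAMILY law -/

section DefiniteAny

open Polynomial
open Summit.ValiantsHypothesis.ValiantsHypothesis.Theorems.LacunarySymmetroidMatrixDescartes

variable {m L : ℕ}

/-- **ABSTRACT DEFINITE-TYPE CENSUS THEOREM for one-pivot words** `F(X) = X^{d₀} P₀ + X^{d₀+e} J + Σₗ X^{d₀+δₗ} Pₗ` (`P₀ ≻ 0`,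
`J` ANY symmetric, `Pₗ ⪰ 0`, `δₗ > e ≥ 1`, a positive definite top letter `P_{l₁}`).  HYPOTHESIS `hlaw`: every FAMILY of entering-type
kernel pairs of the reduced word at positive scales, indexed by any finite type in `Type` (= `Type 0`; scales may repeat; two different vectors at one scale polarised for the type form
`e P₀ − Σₗ (δₗ − e)τ^{δₗ} Pₗ`) has at most `R` members.  CONCLUSION: if every positive root of `det F` is of DEFINITE type (any corank),
then the positive roots counted WITH MULTIPLICITY number at most `2R` — `N⁻ = Σ corank` over the distinct entering roots
(`Inertia.sum_corank_eq_card_roots_filter`), orthogonal kernel bases (`exists_kernel_orthogonal_family`) form one family, and `N⁺ = N⁻`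
(`Inertia.global_index_formula`, `ν(P₀) = ν(P_{l₁}) = 0`).  Instances below: clustered supports (`R = rank P₀`) and commensurable supports
(`R = rank P₀ + Σₗ qₗ rank Pₗ`). [folklore] -/
theorem card_posRoots_le_of_negType_family_law (P₀ J : Matrix (Fin m) (Fin m) ℝ) (P : Fin L → Matrix (Fin m) (Fin m) ℝ)
    (hP₀ : P₀.PosDef) (hJ : J.IsSymm) (hP : ∀ l, (P l).PosSemidef) (l₁ : Fin L) (htop : (P l₁).PosDef)
    (d₀ e : ℕ) (δ : Fin L → ℕ) (he : 0 < e) (hδ : ∀ l, e < δ l) (hδtop : ∀ l, l ≠ l₁ → δ l < δ l₁) (R : ℕ)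
    (hlaw : ∀ (I : Type) [Fintype I] [DecidableEq I] (τ : I → ℝ) (u : I → Fin m → ℝ), (∀ i, 0 < τ i) →
      (∀ i, (P₀ + τ i ^ e • J + ∑ l, τ i ^ δ l • P l) *ᵥ u i = 0) →
      (∀ i, ∑ l, ((δ l - e : ℕ) : ℝ) * τ i ^ δ l * (u i ⬝ᵥ (P l *ᵥ u i)) < e * (u i ⬝ᵥ (P₀ *ᵥ u i))) →
      (∀ i k, i ≠ k → τ i = τ k →
        (e : ℝ) * (u i ⬝ᵥ (P₀ *ᵥ u k)) = ∑ l, ((δ l - e : ℕ) : ℝ) * τ k ^ δ l * (u i ⬝ᵥ (P l *ᵥ u k))) →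
      Fintype.card I ≤ R)
    (htype : ∀ t : ℝ, 0 < t →
      (∑ k : Fin (L + 2), t ^ (Matrix.vecCons d₀ (Matrix.vecCons (d₀ + e) fun l => d₀ + δ l) k) •
        (Matrix.vecCons P₀ (Matrix.vecCons J P) k)).det = 0 →
      (∀ u : Fin m → ℝ, (∑ k : Fin (L + 2), t ^ (Matrix.vecCons d₀ (Matrix.vecCons (d₀ + e) fun l => d₀ + δ l) k) •
          (Matrix.vecCons P₀ (Matrix.vecCons J P) k)) *ᵥ u = 0 → u ≠ 0 →
        (derivative (∑ k : Fin (L + 2), C (u ⬝ᵥ ((Matrix.vecCons P₀ (Matrix.vecCons J P) k) *ᵥ u)) *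
          (X : ℝ[X]) ^ (Matrix.vecCons d₀ (Matrix.vecCons (d₀ + e) fun l => d₀ + δ l) k))).eval t < 0) ∨
      (∀ u : Fin m → ℝ, (∑ k : Fin (L + 2), t ^ (Matrix.vecCons d₀ (Matrix.vecCons (d₀ + e) fun l => d₀ + δ l) k) •
          (Matrix.vecCons P₀ (Matrix.vecCons J P) k)) *ᵥ u = 0 → u ≠ 0 →
        0 < (derivative (∑ k : Fin (L + 2), C (u ⬝ᵥ ((Matrix.vecCons P₀ (Matrix.vecCons J P) k) *ᵥ u)) *
          (X : ℝ[X]) ^ (Matrix.vecCons d₀ (Matrix.vecCons (d₀ + e) fun l => d₀ + δ l) k))).eval t)) :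
    Multiset.card ((Matrix.det (∑ k : Fin (L + 2),
        ((X : ℝ[X]) ^ (Matrix.vecCons d₀ (Matrix.vecCons (d₀ + e) fun l => d₀ + δ l) k)) •
          (Matrix.vecCons P₀ (Matrix.vecCons J P) k).map C)).roots.filter (fun t => 0 < t)) ≤ 2 * R := by
  classical
  set dv : Fin (L + 2) → ℕ := Matrix.vecCons d₀ (Matrix.vecCons (d₀ + e) fun l => d₀ + δ l) with hdv
  set Sv : Fin (L + 2) → Matrix (Fin m) (Fin m) ℝ := Matrix.vecCons P₀ (Matrix.vecCons J P) with hSv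
  have hP₀s : P₀.IsSymm := by
    have h1 := hP₀.1; unfold Matrix.IsHermitian at h1
    rwa [Matrix.conjTranspose_eq_transpose_of_trivial] at h1
  have hPs : ∀ l, (P l).IsSymm := by
    intro l; have h1 := (hP l).1; unfold Matrix.IsHermitian at h1
    rwa [Matrix.conjTranspose_eq_transpose_of_trivial] at h1
  have hS : ∀ k, (Sv k).IsSymm := by
    intro k
    refine Fin.cases ?_ (fun k => ?_) k
    · simpa [hSv] using hP₀s
    · refine Fin.cases ?_ (fun l => ?_) k
      · simpa [hSv] using hJ
      · simpa [hSv] using hPs l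
  have hdv0 : dv 0 = d₀ := by simp [hdv]
  have hdv1 : dv 1 = d₀ + e := by simp [hdv]
  have hdvl : ∀ l : Fin L, dv l.succ.succ = d₀ + δ l := by intro l; simp [hdv]
  have hmin : ∀ k : Fin (L + 2), k ≠ 0 → dv 0 < dv k := by
    intro k hk
    rw [hdv0]
    revert hk
    refine Fin.cases ?_ (fun k => ?_) k
    · intro h; exact absurd rfl h
    · intro _
      refine Fin.cases ?_ (fun l => ?_) k
      · show d₀ < dv 1; rw [hdv1]; omega
      · rw [hdvl]; have := hδ l; omega
  have hmax : ∀ k : Fin (L + 2), k ≠ l₁.succ.succ → dv k < dv l₁.succ.succ := by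
    intro k hk
    rw [hdvl l₁]
    revert hk
    refine Fin.cases ?_ (fun k => ?_) k
    · intro _; rw [hdv0]; have := hδ l₁; omega
    · refine Fin.cases ?_ (fun l => ?_) k
      · intro _; show dv 1 < d₀ + δ l₁; rw [hdv1]; have := hδ l₁; omega
      · intro hne
        rw [hdvl]
        have hl : l ≠ l₁ := fun h => hne (by rw [h])
        have := hδtop l hl
        omega
  have h0 : (Sv 0).det ≠ 0 := by
    show (Matrix.vecCons P₀ (Matrix.vecCons J P) 0).det ≠ 0
    simp only [Matrix.cons_val_zero]; exact hP₀.det_pos.ne'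
  have h2 : (Sv l₁.succ.succ).det ≠ 0 := by
    show (Matrix.vecCons P₀ (Matrix.vecCons J P) l₁.succ.succ).det ≠ 0
    simp only [Matrix.cons_val_succ]; exact htop.det_pos.ne'
  let negType : ℝ → Prop := fun t => ∀ u : Fin m → ℝ, (∑ k, t ^ dv k • Sv k) *ᵥ u = 0 → u ≠ 0 →
    (derivative (∑ k, C (u ⬝ᵥ (Sv k *ᵥ u)) * (X : ℝ[X]) ^ dv k)).eval t < 0
  obtain ⟨hidx, -, hsum⟩ := Inertia.global_index_formula dv Sv hS 0 l₁.succ.succ hmin hmax h0 h2 htype negType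
    (fun t _ _ => Iff.rfl)
  have hν0 : Fintype.card {j // (Inertia.isHermitian_of_isSymm (hS 0)).eigenvalues j < 0} = 0 := by
    rw [Fintype.card_eq_zero_iff]
    refine ⟨fun ⟨j, hj⟩ => ?_⟩
    have hP₀' : (Sv 0).PosDef := by
      show (Matrix.vecCons P₀ (Matrix.vecCons J P) 0).PosDef
      simp only [Matrix.cons_val_zero]; exact hP₀
    have hp : 0 < (Inertia.isHermitian_of_isSymm (hS 0)).eigenvalues j := hP₀'.eigenvalues_pos j
    linarith
  have hν2 : Fintype.card {j // (Inertia.isHermitian_of_isSymm (hS l₁.succ.succ)).eigenvalues j < 0} = 0 := by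
    rw [Fintype.card_eq_zero_iff]
    refine ⟨fun ⟨j, hj⟩ => ?_⟩
    have htop' : (Sv l₁.succ.succ).PosDef := by
      show (Matrix.vecCons P₀ (Matrix.vecCons J P) l₁.succ.succ).PosDef
      simp only [Matrix.cons_val_succ]; exact htop
    have hp : 0 < (Inertia.isHermitian_of_isSymm (hS l₁.succ.succ)).eigenvalues j := htop'.eigenvalues_pos j
    linarith
  rw [hν0, hν2, zero_add, zero_add] at hidx
  set Pd := Matrix.det (∑ k, ((X : ℝ[X]) ^ dv k) • (Sv k).map C) with hPd
  set q : ℝ → Prop := fun t => 0 < t ∧ negType t with hq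
  set T := Pd.roots.toFinset.filter q with hTdef
  have hTpos : ∀ t ∈ T, 0 < t := fun t ht => (Finset.mem_filter.mp ht).2.1
  have hdetT : ∀ t ∈ T, (∑ k, t ^ dv k • Sv k).det = 0 := by
    intro t ht
    obtain ⟨hmem, -⟩ := Finset.mem_filter.mp ht
    obtain ⟨-, hroot⟩ := (Polynomial.mem_roots').mp (Multiset.mem_toFinset.mp hmem)
    have h1 : Pd.eval t = 0 := hroot
    rwa [hPd, DefiniteMoments.eval_det_pencil] at h1
  have hdef : ∀ t ∈ T, ∀ v : Fin m → ℝ, (∑ k, t ^ dv k • Sv k) *ᵥ v = 0 → v ≠ 0 →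
      (derivative (∑ k, C (v ⬝ᵥ (Sv k *ᵥ v)) * (X : ℝ[X]) ^ dv k)).eval t ≠ 0 := by
    intro t ht v hv hv0
    rcases htype t (hTpos t ht) (hdetT t ht) with h | h
    · exact ne_of_lt (h v hv hv0)
    · exact ne_of_gt (h v hv hv0)
  have hN : ∑ t ∈ T, (Fintype.card (Fin m) - (∑ k, t ^ dv k • Sv k).rank) = Multiset.card (Pd.roots.filter q) :=
    Inertia.sum_corank_eq_card_roots_filter dv Sv hS q hdef
  have hTtype : ∀ t ∈ T, ∀ u : Fin m → ℝ, (∑ k, t ^ dv k • Sv k) *ᵥ u = 0 → u ≠ 0 →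
      (derivative (∑ k, C (u ⬝ᵥ (Sv k *ᵥ u)) * (X : ℝ[X]) ^ dv k)).eval t < 0 :=
    fun t ht u hu hu0 => (Finset.mem_filter.mp ht).2.2 u hu hu0
  -- orthogonal kernel families for the type form `e P₀ − Σₗ (δₗ − e) t^{δₗ} Pₗ`
  have hfam : ∀ t : ℝ, ∃ v : Fin (m - (∑ k, t ^ dv k • Sv k).rank) → (Fin m → ℝ),
      (∀ j, (∑ k, t ^ dv k • Sv k) *ᵥ v j = 0) ∧ (∀ j, v j ≠ 0) ∧
      ∀ j j', j ≠ j' → v j ⬝ᵥ ((((e : ℝ)) • P₀ - ∑ l, (((δ l - e : ℕ) : ℝ) * t ^ δ l) • P l) *ᵥ v j') = 0 := by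
    intro t
    refine exists_kernel_orthogonal_family _ _ ?_
    unfold Matrix.IsSymm
    rw [Matrix.transpose_sub, Matrix.transpose_smul, Matrix.transpose_sum, hP₀s]
    congr 1
    exact Finset.sum_congr rfl fun l _ => by rw [Matrix.transpose_smul, hPs l]
  choose v hv0 hvne hvorth using hfam
  have hpol : ∀ t : ℝ, ∀ j j', j ≠ j' →
      (e : ℝ) * (v t j ⬝ᵥ (P₀ *ᵥ v t j')) = ∑ l, ((δ l - e : ℕ) : ℝ) * t ^ δ l * (v t j ⬝ᵥ (P l *ᵥ v t j')) := by
    intro t j j' hjj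
    have h := hvorth t j j' hjj
    rw [Matrix.sub_mulVec, Matrix.smul_mulVec, Matrix.sum_mulVec, dotProduct_sub, dotProduct_smul, dotProduct_sum,
      smul_eq_mul, sub_eq_zero] at h
    rw [h]
    refine Finset.sum_congr rfl fun l _ => ?_
    rw [Matrix.smul_mulVec, dotProduct_smul, smul_eq_mul]
  let Idx := Σ t : T, Fin (m - (∑ k, (t : ℝ) ^ dv k • Sv k).rank)
  have hcard : Fintype.card Idx = ∑ t ∈ T, (Fintype.card (Fin m) - (∑ k, t ^ dv k • Sv k).rank) := by
    rw [Fintype.card_sigma]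
    simp only [Fintype.card_fin]
    exact (Finset.sum_coe_sort T (fun t => m - (∑ k, t ^ dv k • Sv k).rank))
  have hbound : Fintype.card Idx ≤ R := by
    refine hlaw Idx (fun p => ((p.1 : ℝ))) (fun p => v p.1 p.2) (fun p => hTpos p.1 p.1.2)
      (fun p => reduced_kernel_clustered P₀ J P d₀ e δ (hTpos p.1 p.1.2) _ (hv0 p.1 p.2)) ?_ ?_
    · intro p
      have ht := hTpos p.1 p.1.2
      have hneg := hTtype p.1 p.1.2 (v p.1 p.2) (hv0 p.1 p.2) (hvne p.1 p.2)
      have heq := rayleigh_deriv_eq_clustered P₀ J P d₀ e δ (fun l => (hδ l).le) ht _ (hv0 p.1 p.2)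
      have h1 : (p.1 : ℝ) * (derivative (∑ k : Fin (L + 2),
          C (v p.1 p.2 ⬝ᵥ ((Matrix.vecCons P₀ (Matrix.vecCons J P) k) *ᵥ v p.1 p.2)) *
          (X : ℝ[X]) ^ (Matrix.vecCons d₀ (Matrix.vecCons (d₀ + e) fun l => d₀ + δ l) k))).eval (p.1 : ℝ) < 0 :=
        mul_neg_of_pos_of_neg ht hneg
      rw [heq] at h1
      have h2 : 0 < (p.1 : ℝ) ^ d₀ := pow_pos ht _
      by_contra hcon
      push Not at hcon
      have h3 : 0 ≤ (∑ l, ((δ l - e : ℕ) : ℝ) * ((p.1 : ℝ)) ^ δ l * (v p.1 p.2 ⬝ᵥ (P l *ᵥ v p.1 p.2)))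
          - e * (v p.1 p.2 ⬝ᵥ (P₀ *ᵥ v p.1 p.2)) := by linarith
      have := mul_nonneg h2.le h3
      linarith
    · rintro ⟨t, j⟩ ⟨t', j'⟩ hne htt'
      simp only at htt'
      have htt : t = t' := Subtype.ext htt'
      subst htt
      have hjj : j ≠ j' := fun h => hne (by subst h; rfl)
      exact hpol t j j' hjj
  rw [← hsum]
  have hNle : Multiset.card (Pd.roots.filter q) ≤ R := by
    rw [← hN, ← hcard]; exact hbound
  have hidx' : Multiset.card (Pd.roots.filter fun t => 0 < t ∧ ¬ negType t) = Multiset.card (Pd.roots.filter q) := hidx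
  rw [hidx']
  omega

/-- **CLUSTERED WORDS OF ANY LENGTH, DEFINITE TYPE (any corank)**: `P₀ ≻ 0`, `J` arbitrary, PSD letters at `e < δₗ ≤ 2e`, top letter
`≻ 0`; definite type at every positive root ⇒ `Z₊ ≤ 2m` with multiplicity (the `hcorank` of `card_posRoots_le_two_mul_clustered` removed).
[folklore] -/
theorem card_posRoots_le_two_mul_clustered_of_definite (P₀ J : Matrix (Fin m) (Fin m) ℝ) (P : Fin L → Matrix (Fin m) (Fin m) ℝ)
    (hP₀ : P₀.PosDef) (hJ : J.IsSymm) (hP : ∀ l, (P l).PosSemidef) (l₁ : Fin L) (htop : (P l₁).PosDef)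
    (d₀ e : ℕ) (δ : Fin L → ℕ) (he : 0 < e) (hδ : ∀ l, e < δ l ∧ δ l ≤ 2 * e) (hδtop : ∀ l, l ≠ l₁ → δ l < δ l₁)
    (htype : ∀ t : ℝ, 0 < t →
      (∑ k : Fin (L + 2), t ^ (Matrix.vecCons d₀ (Matrix.vecCons (d₀ + e) fun l => d₀ + δ l) k) •
        (Matrix.vecCons P₀ (Matrix.vecCons J P) k)).det = 0 →
      (∀ u : Fin m → ℝ, (∑ k : Fin (L + 2), t ^ (Matrix.vecCons d₀ (Matrix.vecCons (d₀ + e) fun l => d₀ + δ l) k) •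
          (Matrix.vecCons P₀ (Matrix.vecCons J P) k)) *ᵥ u = 0 → u ≠ 0 →
        (derivative (∑ k : Fin (L + 2), C (u ⬝ᵥ ((Matrix.vecCons P₀ (Matrix.vecCons J P) k) *ᵥ u)) *
          (X : ℝ[X]) ^ (Matrix.vecCons d₀ (Matrix.vecCons (d₀ + e) fun l => d₀ + δ l) k))).eval t < 0) ∨
      (∀ u : Fin m → ℝ, (∑ k : Fin (L + 2), t ^ (Matrix.vecCons d₀ (Matrix.vecCons (d₀ + e) fun l => d₀ + δ l) k) •
          (Matrix.vecCons P₀ (Matrix.vecCons J P) k)) *ᵥ u = 0 → u ≠ 0 →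
        0 < (derivative (∑ k : Fin (L + 2), C (u ⬝ᵥ ((Matrix.vecCons P₀ (Matrix.vecCons J P) k) *ᵥ u)) *
          (X : ℝ[X]) ^ (Matrix.vecCons d₀ (Matrix.vecCons (d₀ + e) fun l => d₀ + δ l) k))).eval t)) :
    Multiset.card ((Matrix.det (∑ k : Fin (L + 2),
        ((X : ℝ[X]) ^ (Matrix.vecCons d₀ (Matrix.vecCons (d₀ + e) fun l => d₀ + δ l) k)) •
          (Matrix.vecCons P₀ (Matrix.vecCons J P) k).map C)).roots.filter (fun t => 0 < t)) ≤ 2 * m := by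
  have h := card_posRoots_le_of_negType_family_law P₀ J P hP₀ hJ hP l₁ htop d₀ e δ he (fun l => (hδ l).1) hδtop P₀.rank
    (fun I _ _ τ u hτ hker hty hsame =>
      card_negType_family_le_rank_clustered P₀ J P e δ τ u hP₀.posSemidef hJ hP hτ he hδ hker hty hsame) htype
  exact h.trans (Nat.mul_le_mul_left 2 ((Matrix.rank_le_width P₀).trans le_rfl))

/-- **COMMENSURABLE SUPPORTS, DEFINITE TYPE (any corank)**: `P₀ ≻ 0`, `J` arbitrary, PSD letters at `e(qₗ + 1)`, `qₗ ≥ 1`, top letter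
`≻ 0`; definite type at every positive root ⇒ `Z₊ ≤ 2(m + m Σₗ qₗ)` with multiplicity (the `hcorank` of `card_posRoots_le_commensurable`
removed). [folklore] -/
theorem card_posRoots_le_commensurable_of_definite (P₀ J : Matrix (Fin m) (Fin m) ℝ) (P : Fin L → Matrix (Fin m) (Fin m) ℝ)
    (hP₀ : P₀.PosDef) (hJ : J.IsSymm) (hP : ∀ l, (P l).PosSemidef) (l₁ : Fin L) (htop : (P l₁).PosDef)
    (d₀ e : ℕ) (q : Fin L → ℕ) (he : 0 < e) (hq : ∀ l, 1 ≤ q l) (hqtop : ∀ l, l ≠ l₁ → q l < q l₁)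
    (htype : ∀ t : ℝ, 0 < t →
      (∑ k : Fin (L + 2), t ^ (Matrix.vecCons d₀ (Matrix.vecCons (d₀ + e) fun l => d₀ + e * (q l + 1)) k) •
        (Matrix.vecCons P₀ (Matrix.vecCons J P) k)).det = 0 →
      (∀ u : Fin m → ℝ, (∑ k : Fin (L + 2), t ^ (Matrix.vecCons d₀ (Matrix.vecCons (d₀ + e) fun l => d₀ + e * (q l + 1)) k) •
          (Matrix.vecCons P₀ (Matrix.vecCons J P) k)) *ᵥ u = 0 → u ≠ 0 →
        (derivative (∑ k : Fin (L + 2), C (u ⬝ᵥ ((Matrix.vecCons P₀ (Matrix.vecCons J P) k) *ᵥ u)) *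
          (X : ℝ[X]) ^ (Matrix.vecCons d₀ (Matrix.vecCons (d₀ + e) fun l => d₀ + e * (q l + 1)) k))).eval t < 0) ∨
      (∀ u : Fin m → ℝ, (∑ k : Fin (L + 2), t ^ (Matrix.vecCons d₀ (Matrix.vecCons (d₀ + e) fun l => d₀ + e * (q l + 1)) k) •
          (Matrix.vecCons P₀ (Matrix.vecCons J P) k)) *ᵥ u = 0 → u ≠ 0 →
        0 < (derivative (∑ k : Fin (L + 2), C (u ⬝ᵥ ((Matrix.vecCons P₀ (Matrix.vecCons J P) k) *ᵥ u)) *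
          (X : ℝ[X]) ^ (Matrix.vecCons d₀ (Matrix.vecCons (d₀ + e) fun l => d₀ + e * (q l + 1)) k))).eval t)) :
    Multiset.card ((Matrix.det (∑ k : Fin (L + 2),
        ((X : ℝ[X]) ^ (Matrix.vecCons d₀ (Matrix.vecCons (d₀ + e) fun l => d₀ + e * (q l + 1)) k)) •
          (Matrix.vecCons P₀ (Matrix.vecCons J P) k).map C)).roots.filter (fun t => 0 < t)) ≤ 2 * (m + m * ∑ l, q l) := by
  have hmul : ∀ l, e < e * (q l + 1) := by
    intro l
    have := hq l
    calc e = e * 1 := (Nat.mul_one e).symm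
      _ < e * (q l + 1) := Nat.mul_lt_mul_of_pos_left (by omega) he
  have hmultop : ∀ l, l ≠ l₁ → e * (q l + 1) < e * (q l₁ + 1) :=
    fun l hl => Nat.mul_lt_mul_of_pos_left (by have := hqtop l hl; omega) he
  have h := card_posRoots_le_of_negType_family_law P₀ J P hP₀ hJ hP l₁ htop d₀ e (fun l => e * (q l + 1)) he hmul hmultop
    (P₀.rank + ∑ l, q l * (P l).rank)
    (fun I _ _ τ u hτ hker hty hsame =>
      card_negType_family_le_rank_commensurable P₀ J P e (fun l => e * (q l + 1)) τ u q hP₀.posSemidef hJ hP hτ he hq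
        (fun l => rfl) hker hty hsame) htype
  refine h.trans (Nat.mul_le_mul_left 2 (Nat.add_le_add ((Matrix.rank_le_width P₀).trans le_rfl) ?_))
  rw [Finset.mul_sum]
  exact Finset.sum_le_sum fun l _ => by
    calc q l * (P l).rank ≤ q l * m := Nat.mul_le_mul_left _ ((Matrix.rank_le_width (P l)).trans le_rfl)
      _ = m * q l := Nat.mul_comm _ _

end DefiniteAny

end TwoSidedThree

end Summit.ValiantsHypothesis.ValiantsHypothesis.Theorems.KPlusLogSqLaw.TowerGraft
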